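import Literature.IUT.LogVolume.TensorPacketUnramifiedShell
import Literature.IUT.LogVolume.TensorPacketShell
import Literature.IUT.LogVolume.UnitLogUnramifiedDyadicArtinSchreier
import HarnessLib

/-!
# The log-shell lattice of a DYADIC SPLIT tensor packet IS its integral structure (`p = 2`, every factor `≅ ℚ₂`:
# `e_i = f_i = 1`) — the `p = 2` twin of `TensorPacketUnramifiedShell`

[IUTchIV] Prop. 1.2 (i) (RIMS ms Apr. 2020 = PRIMS **57** (2021), kurims p. 10): "`p^{a_i}·R_i ⊆ log_p(R_i^×) ⊆ p^{−b_i}·R_i`",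
with `a_i := 2` when `p = 2`; Thm. 1.10 Step (vi), p. 29: the container "is precisely equal to the tensor product of log-shells
under consideration". `TensorPacketUnramifiedShell` (abc-iut-c312-3) proves `((2p)^{|I|})⁻¹·log_p(R_I^×) = (R_I)^∼` for `p > 2`
and all `e_i = 1`. THIS FILE is the dyadic twin in the SPLIT case: `p = 2` and every factor `k_i` absolutely unramified with
residue field `𝔽₂` (`e_i = f_i = 1`, i.e. `k_i ≅ ℚ₂` — every packet over `2` of a number field in which `2` splits completely,
e.g. `F = ℚ`). Then, by abc-iut-w5-d180's `UnramifiedDyadic.logUnits_eq_closedBall_four_of_residueDegree_eq_one`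
(`log₂(𝒪^×) = 4𝒪`, e.g. `log₂(ℤ₂^×) = 4ℤ₂`; Neukirch II (5.5)):

* `mem_logUnits_iff_norm_le_of_dyadicSplit` — per factor `z ∈ log₂(R_i^×) ↔ ‖z‖ ≤ 1/4`;
* `coe_logPacket_eq_four_pow_smul_integerPacket` — `log₂(R_I^×) = 4^{|I|}·R_I` as subsets of `V` (`⊗(4·y_i) = 4^{|I|}·⊗y_i`);
* **`inv_two_mul_two_pow_smul_logPacket_eq_normalizedPacket`** — `((2·2)^{|I|})⁻¹·log₂(R_I^×) = (R_I)^∼` for `|I| ≥ 2`: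
  Dupuy–Hilado's `I_{v⃗} = (2p)^{−(j+1)}·⊗ log(O^×_{v̲_i})` EQUALS `O_{v⃗}` at `p = 2` when every factor is `ℚ₂` — so the whole
  odd-unramified hull computation of the cell (abc-iut-c312-5 `Cor312HullStableDHVol` …) has the same INPUT at the dyadic packets
  of such fields (the hypothesis `f ≥ 2` of w5-d180's `logUnits_ne_closedBall` is exactly what fails here);
* `logShell_eq_normalizedPacket_of_dyadicSplit` — the same in abc-iut-c312-3's `logShell`/`shellScalar` vocabulary.
Proof-only; no definitions. [cite: Mochizuki2012, IUTchIV Prop. 1.2 (i) p. 10, Thm 1.10 proof Step (vi) p. 29]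
[cite: NeukirchANT1999, Ch. II Prop. (5.5)] [cite: DupuyHilado2025, §4.7] Nothing here takes a side on [IUTchIII] Cor. 3.12.
-/

noncomputable section

open Set Metric
open scoped Pointwise TensorProduct NormedField

namespace Literature.IUT.LogVolume

variable {I : Type} [Fintype I] [DecidableEq I]
variable (k : I → Type) [∀ i, NontriviallyNormedField (k i)] [∀ i, NormedAlgebra ℚ_[2] (k i)]
  [∀ i, IsUltrametricDist (k i)] [∀ i, ProperSpace (k i)]

/-! ## `log₂(R_i^×) = 4·R_i` per factor -/

section OneFactor

variable {K : Type} [NontriviallyNormedField K] [NormedAlgebra ℚ_[2] K] [IsUltrametricDist K] [ProperSpace K]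

/-- `‖(4 : ℚ₂)‖ = 1/4`. [folklore] -/
private theorem norm_four_padicTwo : ‖(4 : ℚ_[2])‖ = 4⁻¹ := by
  have h2 : ‖((2 : ℕ) : ℚ_[2])‖ = ((2 : ℕ) : ℝ)⁻¹ := Padic.norm_p
  rw [show (4 : ℚ_[2]) = ((2 : ℕ) : ℚ_[2]) * ((2 : ℕ) : ℚ_[2]) by norm_num, norm_mul, h2]
  norm_num

/-- **`log₂(R^×) = 4·R`** for `e = f = 1` (`K ≅ ℚ₂`): `z ∈ log₂(R^×) ↔ ‖z‖ ≤ 1/4` (abc-iut-w5-d180's `log₂(𝒪^×) = 4𝒪`).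
[cite: NeukirchANT1999, Ch. II Prop. (5.5)] [cite: Mochizuki2012, IUTchIV Prop. 1.2 (i) p. 10] -/
theorem mem_logUnits_iff_norm_le_of_dyadicSplit (he : absRamificationIdx 2 K = 1) (hf : residueDegree 2 K = 1) (z : K) :
    z ∈ logUnits K ↔ ‖z‖ ≤ 4⁻¹ := by
  rw [UnramifiedDyadic.logUnits_eq_closedBall_four_of_residueDegree_eq_one he hf, mem_closedBall, dist_zero_right,
    UnramifiedDyadic.norm_four]

/-- For `e = f = 1`: every `z ∈ log₂(R^×)` is `4·y` with `y` integral. [cite: Mochizuki2012, IUTchIV Prop. 1.2 (i) p. 10] -/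
theorem exists_eq_four_smul_of_mem_logUnits (he : absRamificationIdx 2 K = 1) (hf : residueDegree 2 K = 1) {z : K}
    (hz : z ∈ logUnits K) : ∃ y : K, ‖y‖ ≤ 1 ∧ z = (4 : ℚ_[2]) • y := by
  have h4 : (4 : ℚ_[2]) ≠ 0 := by norm_num
  refine ⟨(4 : ℚ_[2])⁻¹ • z, ?_, by rw [smul_smul, mul_inv_cancel₀ h4, one_smul]⟩
  rw [norm_smul, norm_inv, norm_four_padicTwo, inv_inv]
  have h := (mem_logUnits_iff_norm_le_of_dyadicSplit he hf z).mp hz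
  calc (4 : ℝ) * ‖z‖ ≤ 4 * 4⁻¹ := by gcongr
    _ = 1 := by norm_num

/-- For `e = f = 1`: `4·y ∈ log₂(R^×)` for every integral `y`. [cite: Mochizuki2012, IUTchIV Prop. 1.2 (i) p. 10] -/
theorem four_smul_mem_logUnits (he : absRamificationIdx 2 K = 1) (hf : residueDegree 2 K = 1) {y : K} (hy : ‖y‖ ≤ 1) :
    (4 : ℚ_[2]) • y ∈ logUnits K := by
  rw [mem_logUnits_iff_norm_le_of_dyadicSplit he hf, norm_smul, norm_four_padicTwo]
  calc (4 : ℝ)⁻¹ * ‖y‖ ≤ 4⁻¹ * 1 := by gcongr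
    _ = 4⁻¹ := mul_one _

end OneFactor

/-! ## `log₂(R_I^×) = 4^{|I|}·R_I` and the log-shell lattice -/

omit [DecidableEq I] in
/-- **`log₂(R_I^×) = 4^{|I|}·R_I`** (as subsets of `V`) for all `e_i = f_i = 1`: a pure tensor of elements of the
`log₂(R_i^×) = 4·R_i` is `⊗(4·y_i) = 4^{|I|}·⊗y_i` with `⊗y_i ∈ R_I`, and conversely (twin of abc-iut-c312-3's
`coe_logPacket_eq_smul_integerPacket`). [cite: Mochizuki2012, IUTchIV Prop. 1.2 (i) p. 10] -/
theorem coe_logPacket_eq_four_pow_smul_integerPacket (he : ∀ i, absRamificationIdx 2 (k i) = 1)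
    (hf : ∀ i, residueDegree 2 (k i) = 1) :
    (logPacket 2 k : Set (PacketAlgebra 2 k)) =
      ((4 : ℚ_[2]) ^ Fintype.card I) • (integerPacket 2 k : Set (PacketAlgebra 2 k)) := by
  set c : ℚ_[2] := (4 : ℚ_[2]) ^ Fintype.card I with hc
  -- the target as an additive subgroup: the image of `R_I` under `x ↦ c • x`
  let f : PacketAlgebra 2 k →+ PacketAlgebra 2 k := DistribSMul.toAddMonoidHom (PacketAlgebra 2 k) c
  have hcoe : ((integerPacket 2 k).toAddSubgroup.map f : Set (PacketAlgebra 2 k)) =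
      c • (integerPacket 2 k : Set (PacketAlgebra 2 k)) := by
    rw [AddSubgroup.coe_map]; rfl
  refine le_antisymm ?_ ?_
  · -- `⊆`: generators `⊗z`, `z_i ∈ log₂(R_i^×)`, lie in `c·R_I`
    rw [← hcoe]
    refine (AddSubgroup.closure_le _).mpr ?_
    rintro _ ⟨z, hz, rfl⟩
    choose y hy hzy using fun i => exists_eq_four_smul_of_mem_logUnits (he i) (hf i) (hz i)
    have hz' : z = fun i => (4 : ℚ_[2]) • y i := funext hzy
    rw [hcoe, hz', purePacket_smul, Finset.prod_const, Finset.card_univ]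
    exact Set.smul_mem_smul_set (purePacket_mem_integerPacket 2 k hy)
  · -- `⊇`: for `x ∈ R_I`, `c·x ∈ log₂(R_I^×)` — by induction over the additive generators of `R_I`
    rintro _ ⟨x, hx, rfl⟩
    change c • x ∈ (logPacket 2 k : Set (PacketAlgebra 2 k))
    refine integerPacket_induction 2 k (C := fun t => c • t ∈ (logPacket 2 k : Set (PacketAlgebra 2 k)))
      ?_ ?_ ?_ ?_ hx
    · intro y hy
      have h : c • purePacket 2 k y = purePacket 2 k (fun i => (4 : ℚ_[2]) • y i) := by
        rw [purePacket_smul, Finset.prod_const, Finset.card_univ]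
      rw [h]
      exact AddSubgroup.subset_closure ⟨_, fun i => four_smul_mem_logUnits (he i) (hf i) (hy i), rfl⟩
    · rw [smul_zero]; exact (logPacket 2 k).zero_mem
    · intro a b ha hb; rw [smul_add]; exact (logPacket 2 k).add_mem ha hb
    · intro a ha; rw [smul_neg]; exact (logPacket 2 k).neg_mem ha

/-- **The log-shell lattice is the integral structure at a DYADIC SPLIT packet**: for `|I| ≥ 2` and all `e_i = f_i = 1`,
`((2·2)^{|I|})⁻¹·log₂(R_I^×) = (R_I)^∼` — Dupuy–Hilado's `I_{v⃗} = (2p)^{−(j+1)}·⊗_i log(O^×_{v̲_i})` equals `O_{v⃗}` at `p = 2` when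
every factor is `ℚ₂` (`4^{−|I|}·4^{|I|}·R_I = R_I = (R_I)^∼`, the last equality by the trivial differents, abc-iut-c312-3's
`integerPacket_eq_normalizedPacket_of_unramified`). [cite: DupuyHilado2025, §4.7] [cite: Mochizuki2012, IUTchIV Thm 1.10 proof Step (vi) p. 29] -/
theorem inv_two_mul_two_pow_smul_logPacket_eq_normalizedPacket (hI : 2 ≤ Fintype.card I)
    (he : ∀ i, absRamificationIdx 2 (k i) = 1) (hf : ∀ i, residueDegree 2 (k i) = 1) :
    ((2 * (2 : ℕ) : ℚ_[2]) ^ Fintype.card I)⁻¹ • (logPacket 2 k : Set (PacketAlgebra 2 k)) =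
      (normalizedPacket 2 k : Set (PacketAlgebra 2 k)) := by
  rw [coe_logPacket_eq_four_pow_smul_integerPacket k he hf, smul_smul,
    ← integerPacket_eq_normalizedPacket_of_unramified 2 k hI he]
  have hscal : ((2 * (2 : ℕ) : ℚ_[2]) ^ Fintype.card I)⁻¹ * (4 : ℚ_[2]) ^ Fintype.card I = 1 := by
    rw [show (2 * (2 : ℕ) : ℚ_[2]) = 4 by norm_num, inv_mul_cancel₀ (pow_ne_zero _ (by norm_num))]
  rw [hscal, one_smul]

/-- The same in abc-iut-c312-3's vocabulary: **`logShell 2 k = (R_I)^∼`** at a dyadic split packet (`logShell = shellScalar • logPacket`,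
`shellScalar = ((2p)^{|I|})⁻¹`). [cite: DupuyHilado2025, §4.7] -/
theorem logShell_eq_normalizedPacket_of_dyadicSplit (hI : 2 ≤ Fintype.card I)
    (he : ∀ i, absRamificationIdx 2 (k i) = 1) (hf : ∀ i, residueDegree 2 (k i) = 1) :
    logShell 2 k = (normalizedPacket 2 k : Set (PacketAlgebra 2 k)) :=
  inv_two_mul_two_pow_smul_logPacket_eq_normalizedPacket k hI he hf

end Literature.IUT.LogVolume

end
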